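import Summits.AtomisticToContinuum.HydrodynamicLimit.Theses.TwoClocks
import Summits.AtomisticToContinuum.HydrodynamicLimit.Theorems.DenseExcursion.Negative.Dichotomy

/-!
# crux-ideate r2 i4 — consumer-side check for `TwoClocks` (payload route): `DiluteSelfConsistency` is droppable

Since the D-0032 re-type, `_root_.HydrodynamicLimit` carries the packing guard
`∀ t ∈ Ico 0 T, ∀ x, ρ t x * σ ^ 3 < η₀` as a HYPOTHESIS at a universal `η₀` chosen by the prover.
The clock crux of `TwoClocks` already concludes that guarded decl, so its `DiluteSelfConsistency`
antecedent can be dropped: the restated clock is a pure strengthening (one antecedent fewer), it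
implies the filed one, and `closes` re-docks on six binders. Nothing here is an item or a proof of
anything open; it is the exact text a tenure `route edit` would need once stmt-3091 is refuted (or now).
-/

namespace Summit.AtomisticToContinuum.HydrodynamicLimit.Theses.TwoClocks

/-- The clock crux WITHOUT the `DiluteSelfConsistency` antecedent (diluteness comes from the
Statement's own guard at the engine's universal threshold `η₀`). -/
def TransferEntropyClockGuarded : Prop :=
  KineticWindowLDUniform → ClampedTransferWindowLD → TransferActivityTails → EnergyCurrentTails →
    _root_.HydrodynamicLimit

/-- The restated clock implies the filed one (drop an unused antecedent). -/
theorem transferEntropyClock_of_guarded (h : TransferEntropyClockGuarded) : TransferEntropyClock :=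
  fun hK h₃ h₇ h₆ _ => h hK h₃ h₇ h₆

/-- Re-docked deciding theorem: six binders, no `DiluteSelfConsistency`. -/
theorem closes_without_dsc (h₂ : EquilibriumFastWindowLD) (h₅ : LocalGibbsTransfer)
    (h₃ : ClampedTransferWindowLD) (h₆ : EnergyCurrentTails) (h₇ : TransferActivityTails)
    (hC : TransferEntropyClockGuarded) : _root_.HydrodynamicLimit :=
  hC (h₅ h₂) h₃ h₇ h₆

/-- Conversely, given `DiluteSelfConsistency` the two clock statements are equivalent — so the
restate loses nothing if stmt-3091 were true, and survives if it is refuted. -/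
theorem transferEntropyClockGuarded_iff_of_dsc (hS : DiluteSelfConsistency) :
    TransferEntropyClockGuarded ↔ TransferEntropyClock :=
  ⟨transferEntropyClock_of_guarded, fun h hK h₃ h₇ h₆ => h hK h₃ h₇ h₆ hS⟩

/-- The shared crux is literally the negation of the sibling crux `DenseExcursion` (landed iff,
re-exported in the `TwoClocks` namespace: the two route copies of the decl are one proposition). -/
theorem dsc_iff_not_denseExcursion :
    DiluteSelfConsistency ↔ ¬ Summit.AtomisticToContinuum.HydrodynamicLimit.Theses.ImplosionDichotomy.DenseExcursion :=
  (Summit.AtomisticToContinuum.HydrodynamicLimit.Theorems.not_denseExcursion_iff_diluteSelfConsistency).symm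

end Summit.AtomisticToContinuum.HydrodynamicLimit.Theses.TwoClocks
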